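import Mathlib
import Summits.Ventures.HodgeRepro.Tier4.Line4.ConvDecayL1
import Summits.Ventures.HodgeRepro.Tier4.Line4.ArchDistBounds

/-!
# Tier4/Line4/LevelTailDecay — C-L4-LEVELTAIL-HDECAY: the `hdecay` instance of LevelTail for the convolution family

Blind re-derivation cell `pub-hodge-repro`, Tier 4 «prove the step» (README §9–§10), seat t4-L2-p2 g4 (x2 g4's open
glue (c), SEAT END S15225; first-come S15243).  x2's `exists_fibreDominated_of_level_decay_count` (LevelTail p704492)
asks, with `d := archDist W` and `β := 3`, the binder
`hdecay : ∀ N γ, … → ∀ t ∈ S.DT, ∀ t' ∈ S.DT', ‖f N (t⁻¹ γ t')‖ ≤ C · exp (−(3 · archDist W γ))`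
for the level family `f N := (finf ⊗ ffin N) ⋆ f₂ N`.  x2's `exists_norm_conv_le_exp_of_decay_l1_family` (ConvDecayL1
p703826) bounds the family by `C₀ · exp (−3 archDist x)` at every `x`; at `x = t⁻¹ γ t'` with `t`, `t'` in the relatively
compact fundamental domains `DT`, `DT'`, L2-p1's `exists_archDist_le_conj_DT_add` (ArchDistBounds p700699) gives
`archDist γ ≤ archDist (t⁻¹ γ t') + c`, so `C := C₀ · exp (3c)` works for every `N`, `γ`, `t`, `t'`
(the premise `orbitOf γ ∉ E` of the binder is not needed).  Binders of the family theorem verbatim; no printed input.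
HC_CM is NOT proved by anyone in this repository.
-/

set_option autoImplicit false
noncomputable section

namespace Summit.Ventures.HodgeRepro.Tier4.Line4.L1Class

open MeasureTheory Topology Filter NumberField Summit.Ventures.HodgeRepro.Tier4.Common
  Summit.Ventures.HodgeRepro.Tier4.Line1 Summit.Ventures.HodgeRepro.Tier4.Line1.RTF
  Summit.Ventures.HodgeRepro.Tier4.Line4

variable {k : Type} [Field k] [NumberField k] (W : PlaneData k) [MeasurableSpace (GA W)] [BorelSpace (GA W)]

/-- **C-L4-LEVELTAIL-HDECAY**: the `hdecay` binder of `exists_fibreDominated_of_level_decay_count` (`d := archDist W`,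
`β := 3`) for the level family `(finf ⊗ ffin N) ⋆ f₂ N`, from ConvDecayL1's family bound and the conjugation bound. -/
theorem hdecay_of_convDecay (S : Setting (GA W)) {finf : GA W → ℂ} (hdec : HasDecay3 W finf)
    (ffin f₂ : ℕ → GA W → ℂ) (hfin : ∀ N, IsFinFactor W (ffin N))
    (hl1 : ∀ μf : Measure (finitePart W), μf.IsHaarMeasure →
      ∃ M₁ : ℝ, ∀ N, ∫ x : finitePart W, ‖ffin N (x : GA W)‖ ∂μf ≤ M₁)
    (hsup₂ : ∃ M₂ : ℝ, ∀ N x, ‖f₂ N x‖ ≤ M₂) (hsupp₂ : ∃ K : Set (GA W), IsCompact K ∧ ∀ N, tsupport (f₂ N) ⊆ K) :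
    ∃ C : ℝ, 0 ≤ C ∧ ∀ (N : ℕ) (γ : S.Gk), ∀ t ∈ S.DT, ∀ t' ∈ S.DT',
      ‖S.conv (prodFn W finf (ffin N)) (f₂ N) ((t : GA W)⁻¹ * γ * (t' : GA W))‖ ≤
        C * Real.exp (-(3 * archDist W γ)) := by
  obtain ⟨C₀, hC₀, hbound⟩ := exists_norm_conv_le_exp_of_decay_l1_family W S hdec ffin f₂ hfin hl1 hsup₂ hsupp₂
  obtain ⟨c, -, hc⟩ := exists_archDist_le_conj_DT_add W S
  refine ⟨C₀ * Real.exp (3 * c), mul_nonneg hC₀ (Real.exp_pos _).le, fun N γ t ht t' ht' => ?_⟩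
  refine (hbound N _).trans ?_
  have h1 := hc t t' ht ht' γ
  have h2 : Real.exp (-(3 * archDist W ((t : GA W)⁻¹ * γ * (t' : GA W)))) ≤
      Real.exp (3 * c) * Real.exp (-(3 * archDist W γ)) := by
    rw [← Real.exp_add]
    apply Real.exp_le_exp.2
    linarith
  calc C₀ * Real.exp (-(3 * archDist W ((t : GA W)⁻¹ * γ * (t' : GA W))))
      ≤ C₀ * (Real.exp (3 * c) * Real.exp (-(3 * archDist W γ))) := mul_le_mul_of_nonneg_left h2 hC₀
    _ = C₀ * Real.exp (3 * c) * Real.exp (-(3 * archDist W γ)) := by ring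

end Summit.Ventures.HodgeRepro.Tier4.Line4.L1Class

end
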